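import Summits.QuantumFields.BalabanUV.T4Continuum.Support.ShellMeasurePinnedNorm
import Summits.QuantumFields.BalabanUV.T4Continuum.Support.ShellMeasureRayTermsAlong

/-!
# `T4Continuum.ShellMeasureRayTermsPinned` — W-b LOCATED: per-term OSCILLATIONS WITH DECAY into S16's ray bound
# (row S71 of `t4/b2b-balaban-t4-ne7c-p1/LEAVES-NE7c-P1.md` v3.0, the third file of the LOCALITY ROAD opened by the
# owner finding F-ne7cp1-g30-1 «END-II of record is locality-blind»)
(cell `pub-balaban`, sub-cell `t4`, spine estimate NE7c (node U5b); NE7c ROUND-2 crew, unit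
`b2b-balaban-t4-ne7c-formalise-leaf-09` gen 11; ADDITIVE — imports S69 `ShellMeasurePinnedNorm` (owner, p223286: the
pinned weight `pinW`, `sum_mul_le_of_pinned`, the torus pin `pinDist` ∕ `sum_exp_neg_pinDist_le`) and
`ShellMeasureRayTermsAlong` (leaf-02: `hE_of_functionals_along` over S16 `ShellMeasureRayWiring.rayBound_of_analytic_terms`)
ONLY; [folklore]; 0 `def`, 0 `def … : Prop`, 0 sorry, 0 citations)

HONEST FRAMING.  Finite four-torus programme, rung (B)+1 only — NOT infinite volume, NOT a mass gap, NOT the Clay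
problem, NOT summit progress; (B), `BetaPertHyp`, (B^μ) not consumed.  NE7c (`T4IndicatorShell.ShellWeightBound`) is
NOT PRINTED in [Balaban 1983–89] and NOT PROVED; «NE7c ⇐ the named binders» (trigger c3).  Nothing printed is asserted
here and no estimate of Bałaban's is discharged: this file is bookkeeping (Cauchy + mean value + finite sums) on OUR
side of WALL §2 (c) ∕ W-b.  HONEST DEPENDENCY (cell): continuum YM on T⁴ ⇐ BetaPertH ∧ nine spine estimates (0/9
proved); BetaPertH ⇐ (D1) ∧ (D4) ∧ CAP+tail; G-an2-4 gates asym, D1 and NE2/3/4.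

THE POINT (owner finding F-ne7cp1-g30-1, GAPS l.25103; row S71).  END-II's non-Wilson ray binder
`hE : ∀ x ∈ W, ∀ c ∈ [½,1], 𝓔(c•x) ≤ 𝓔 x + (1−c)·B_𝓔` is, on the LD road, fed by `ShellMeasureRayTermsAlong.
hE_of_functionals_along` with `B_𝓔 = 3H̄∕(R−1)`, `H̄ ≥ Σ_{i∈I} 2e_i` — the per-term SUP bounds `e_i` of the localized
terms `𝓔_i` on a ball of the configuration space ((1.18)∕(2.31)∕(2.42) TYPE).  At a live level EVERY localized term of
the action moves with the block (the minimiser is global), so `I ⊇` {all terms} and `Σ_i 2e_i` is VOLUME-EXTENSIVE.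
S16's `rayBound_of_analytic_terms` in fact only consumes per-term OSCILLATIONS along the chart ray; and the oscillation
of a term localized on `X_i` is small when `X_i` is far from the block, because (i) the term is BLIND off `X_i` and
Lipschitz on the ball (Lipschitz constant `2e_i∕r_E` on the half-ball, from the sup pair by Cauchy + mean value — §1),
and (ii) the exponent field's VARIATION along the ray is small far from the block in the PINNED norm of S69
(`e^{δ′ϖ(b)}·‖Z(w) b − Z(0) b‖ ≤ z` — row S70's deliverable, here a BINDER `hpin`).  Hence
`osc_i ≤ Lip_i·e^{−δ′ϖ(X_i)}·z` (§1 `norm_sub_le_of_blind_lipschitzOn_pin`) and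
`H̄_osc = z·Σ_i Lip_i e^{−δ′ϖ(X_i)}` is VOLUME-FREE once the terms are LOCATED (§3: placed on the torus with `≤ m` terms
per site — the (0.26)-type inner sum, a displayed binder — by S69 `sum_exp_neg_pinDist_le`; or, for families indexed by
localization DOMAINS, under a per-anchor BUDGET `Σ_{pos i = y} Lip_i ≤ K₀` of [Balaban1987RG1] (1.20) TYPE —
`locatedSum_le_torus_of_fibreBudget`).  §2 `hE_of_pinned_terms` ∕ `hE_of_pinned_pairs` conclude LITERALLY END-II's
`hE` (+ `hB𝓔`) with `B_𝓔 = 3·(H̄_osc)∕(R−1)` by ONE CALL of S16 — replacing the LD END's extensive `hEb`∕`hsum` currency;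
§3b `hE_of_pinned_terms_torus` is the torus END with `B_𝓔 = 3·(ℓ₀·#B₀·m·K₁ d δ′·z)∕(R−1)`, NO `#ι`, NO `T`.  §4 converts
S70's pinned-norm statement `‖Z(w) − Z(0)‖_{WSup (pinW δ′ ϖ) 1} ≤ z` into `hpin`; §5 is a non-vacuity toy.

DISPLAYED, NOT DISCHARGED (c2 — binders of theorems, no `def … : Prop`): the per-term pairs (`hEd`, `hEb` ∕ `hLip`), the
localization data (`supp`, `hblind`, `hdepth`), the pinned variation `z` (S70), the placement multiplicity `m` ∕ budget
`K₀`, the dictionary `hreal` (node O).  NOT HERE: S70's chain (the value of `z`), the Wilson letters' pinned Lipschitz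
data (S69 §5 ∕ S70 (v)), any instance for Bałaban's `𝐄^{(j)} ∕ 𝐑^{(j)} ∕ 𝐁^{(j)}`; NE7c NOT PROVED; spine PROVED 0∕9.
-/

noncomputable section

open Set Metric Finset

namespace Summit.QuantumFields.BalabanUV.T4Continuum.ShellMeasureRayTermsPinned

open Literature.MathematicalPhysics.QuantumFieldTheory.Balaban1983to89
open B8SectDSource (norm_fderiv_le_of_norm_le)
open B12Decay510Window (K₁)
open TreeLengthTorus (TPt)
open Summit.QuantumFields.BalabanUV.T4Continuum.ShellMeasureMultiGridNorms (WSup)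
open Summit.QuantumFields.BalabanUV.T4Continuum.ShellMeasurePinnedNorm
  (pinW pinW_apply pinDist sum_mul_le_of_pinned sum_exp_neg_pinDist_le)
open Summit.QuantumFields.BalabanUV.T4Continuum.ShellMeasureRayWiring (rayBound_of_analytic_terms rayConst_nonneg)

variable {Λ : Type*} [Fintype Λ] {𝔄 : Type*} [NormedAddCommGroup 𝔄] [NormedSpace ℂ 𝔄]
variable {𝔅 : Type*} [NormedAddCommGroup 𝔅]

/-! ## §1 One term: a functional blind off a located support, Lipschitz on a ball, reads the pinned variation -/

section OneTerm

omit [NormedSpace ℂ 𝔄] in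
/-- **A LOCATED LIPSCHITZ FUNCTIONAL ON A BALL READS ONLY ITS SUPPORT.**  `φ` is blind off the finite support `s` and
`L`-Lipschitz on `ball 0 r_E` (flat sup norm); two fields `A, A′` in that ball agree on `s` up to `t ≥ 0` componentwise
⟹ `‖φ A − φ A′‖ ≤ L·t`.  (Proof: compare the truncations to `s`, which stay in the ball.) [folklore] -/
theorem norm_sub_le_of_blind_lipschitzOn (φ : (Λ → 𝔄) → 𝔅) (s : Finset Λ)
    (hblind : ∀ A A' : Λ → 𝔄, (∀ b ∈ s, A b = A' b) → φ A = φ A')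
    {rE L : ℝ} (hL0 : 0 ≤ L)
    (hL : ∀ A ∈ ball (0 : Λ → 𝔄) rE, ∀ A' ∈ ball (0 : Λ → 𝔄) rE, ‖φ A - φ A'‖ ≤ L * ‖A - A'‖)
    {A A' : Λ → 𝔄} (hA : A ∈ ball (0 : Λ → 𝔄) rE) (hA' : A' ∈ ball (0 : Λ → 𝔄) rE)
    {t : ℝ} (ht : 0 ≤ t) (hs : ∀ b ∈ s, ‖A b - A' b‖ ≤ t) :
    ‖φ A - φ A'‖ ≤ L * t := by
  classical
  -- truncations to the support
  set T : (Λ → 𝔄) → (Λ → 𝔄) := fun B b => if b ∈ s then B b else 0 with hT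
  have hTle : ∀ B : Λ → 𝔄, ‖T B‖ ≤ ‖B‖ := fun B =>
    (pi_norm_le_iff_of_nonneg (norm_nonneg B)).2 fun b => by
      by_cases hb : b ∈ s
      · simp only [hT, hb, if_true]; exact norm_le_pi_norm B b
      · simp only [hT, hb, if_false, norm_zero]; exact norm_nonneg B
  have hTball : ∀ B : Λ → 𝔄, B ∈ ball (0 : Λ → 𝔄) rE → T B ∈ ball (0 : Λ → 𝔄) rE := fun B hB => by
    rw [mem_ball_zero_iff] at hB ⊢
    exact (hTle B).trans_lt hB
  have hφA : φ A = φ (T A) := hblind _ _ fun b hb => by simp [hT, hb]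
  have hφA' : φ A' = φ (T A') := hblind _ _ fun b hb => by simp [hT, hb]
  have hdiff : ‖T A - T A'‖ ≤ t :=
    (pi_norm_le_iff_of_nonneg ht).2 fun b => by
      by_cases hb : b ∈ s
      · simp only [Pi.sub_apply, hT, hb, if_true]; exact hs b hb
      · simp only [Pi.sub_apply, hT, hb, if_false, sub_zero, norm_zero]; exact ht
  rw [hφA, hφA']
  exact (hL _ (hTball A hA) _ (hTball A' hA')).trans (mul_le_mul_of_nonneg_left hdiff hL0)

omit [NormedSpace ℂ 𝔄] in
/-- **… AND THEREFORE SEES THE PIN.**  If moreover the support lies at pin-depth `≥ r` (`r ≤ ϖ b` on `s`), `δ′ ≥ 0`, and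
the two fields differ by at most `z` in the PINNED sense `e^{δ′ϖ b}·‖A b − A′ b‖ ≤ z` for every `b`, then
`‖φ A − φ A′‖ ≤ L·e^{−δ′r}·z` — the per-term oscillation of row S71 (S69 (B) `norm_sub_le_of_blind_lipschitz` with the
Lipschitz hypothesis RESTRICTED to the ball, as analytic terms require). [folklore] -/
theorem norm_sub_le_of_blind_lipschitzOn_pin (φ : (Λ → 𝔄) → 𝔅) (s : Finset Λ)
    (hblind : ∀ A A' : Λ → 𝔄, (∀ b ∈ s, A b = A' b) → φ A = φ A')
    {rE L : ℝ} (hL0 : 0 ≤ L)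
    (hL : ∀ A ∈ ball (0 : Λ → 𝔄) rE, ∀ A' ∈ ball (0 : Λ → 𝔄) rE, ‖φ A - φ A'‖ ≤ L * ‖A - A'‖)
    (ϖ : Λ → ℝ) {δ' r : ℝ} (hδ' : 0 ≤ δ') (hs : ∀ b ∈ s, r ≤ ϖ b)
    {A A' : Λ → 𝔄} (hA : A ∈ ball (0 : Λ → 𝔄) rE) (hA' : A' ∈ ball (0 : Λ → 𝔄) rE)
    {z : ℝ} (hz : 0 ≤ z) (hpin : ∀ b, Real.exp (δ' * ϖ b) * ‖A b - A' b‖ ≤ z) :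
    ‖φ A - φ A'‖ ≤ L * Real.exp (-(δ' * r)) * z := by
  rw [mul_assoc]
  refine norm_sub_le_of_blind_lipschitzOn φ s hblind hL0 hL hA hA' (by positivity) fun b hb => ?_
  -- on the support: `‖A b − A′ b‖ ≤ e^{−δ′ϖ b}·z ≤ e^{−δ′r}·z`
  have hw : 0 < Real.exp (δ' * ϖ b) := Real.exp_pos _
  have h1 : ‖A b - A' b‖ ≤ Real.exp (-(δ' * ϖ b)) * z := by
    rw [Real.exp_neg, ← div_eq_inv_mul, le_div_iff₀ hw, mul_comm]
    exact hpin b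
  refine h1.trans (mul_le_mul_of_nonneg_right (Real.exp_le_exp.2 ?_) hz)
  exact neg_le_neg (mul_le_mul_of_nonneg_left (hs b hb) hδ')

/-- **THE LIPSCHITZ CONSTANT FROM THE SUP PAIR** (Cauchy + mean value): `φ` complex differentiable on `ball 0 r_E` with
`‖φ‖ ≤ e` there ⟹ `φ` is `(2e∕r_E)`-Lipschitz on the HALF ball `ball 0 (r_E∕2)` (`B8SectDSource.norm_fderiv_le_of_norm_le`:
`‖Dφ(x)‖ ≤ e∕(r_E − ‖x‖) ≤ 2e∕r_E` there; `Convex.norm_image_sub_le_of_norm_fderiv_le`).  This is how a per-term pair of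
(1.18)∕(2.31)∕(2.42) TYPE yields `Lip_i = 2e_i∕r_E` — nothing printed asserted. [folklore] -/
theorem lipschitzOn_half_of_pair {𝔉 : Type*} [NormedAddCommGroup 𝔉] [NormedSpace ℂ 𝔉] {φ : (Λ → 𝔄) → 𝔉}
    {rE e : ℝ} (hd : DifferentiableOn ℂ φ (ball 0 rE)) (he : ∀ Z ∈ ball (0 : Λ → 𝔄) rE, ‖φ Z‖ ≤ e) :
    ∀ A ∈ ball (0 : Λ → 𝔄) (rE / 2), ∀ A' ∈ ball (0 : Λ → 𝔄) (rE / 2), ‖φ A - φ A'‖ ≤ 2 * e / rE * ‖A - A'‖ := by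
  intro A hA A' hA'
  have hArE : ‖A‖ < rE / 2 := mem_ball_zero_iff.1 hA
  have hrE : 0 < rE := by linarith [norm_nonneg A]
  have he0 : 0 ≤ e := (norm_nonneg _).trans (he A (mem_ball_zero_iff.2 (by linarith)))
  have hsub : ball (0 : Λ → 𝔄) (rE / 2) ⊆ ball 0 rE := ball_subset_ball (by linarith)
  -- derivative bound on the half ball
  have hbound : ∀ x ∈ ball (0 : Λ → 𝔄) (rE / 2), ‖fderiv ℂ φ x‖ ≤ 2 * e / rE := by
    intro x hx
    have hx' : ‖x‖ < rE / 2 := mem_ball_zero_iff.1 hx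
    refine (norm_fderiv_le_of_norm_le hd he (by linarith)).trans ?_
    rw [div_le_div_iff₀ (by linarith) hrE]
    nlinarith
  have hdiffAt : ∀ x ∈ ball (0 : Λ → 𝔄) (rE / 2), DifferentiableAt ℂ φ x := fun x hx =>
    hd.differentiableAt (isOpen_ball.mem_nhds (hsub hx))
  have h := (convex_ball (0 : Λ → 𝔄) (rE / 2)).norm_image_sub_le_of_norm_fderiv_le hdiffAt hbound hA' hA
  exact h

end OneTerm

/-! ## §2 The END: END-II's `hE` ∕ `hB𝓔` from located, pinned per-term data — ONE CALL of S16 -/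

section EndTwo

variable {E : Type*} [AddCommGroup E] [Module ℝ E]

/-- **`hE` FROM PINNED PER-TERM OSCILLATIONS (row S71).**  Data: a finite set `I` of term functionals
`Ef i : (Λ → 𝔄) → ℂ`, each complex differentiable on `ball 0 r_E` (flat sup norm), BLIND off its support `supp i`, and
`Lip i`-Lipschitz on the ball; a pin profile `ϖ` with rate `δ′ ≥ 0` and support depths `ϖP i ≤ ϖ b` on `supp i`; per
window point `x ∈ W` a holomorphic curve `𝓗 x` on the disc `‖w‖ < R` (`R > 1`) INTO `ball 0 r_E` whose PINNED VARIATION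
is `≤ z` (`e^{δ′ϖ b}·‖𝓗 x w b − 𝓗 x 0 b‖ ≤ z` — row S70's deliverable, a binder here); the located sum
`Σ_{i∈I} Lip i·e^{−δ′ϖP i} ≤ LK`; the DICTIONARY `Re Σ_i Ef i (𝓗 x c) = 𝓔 (c • x)` on `[0,1]`.  CONCLUSION — LITERALLY
END-II's binder: `∀ x ∈ W, ∀ c, ½ ≤ c → c ≤ 1 → 𝓔 (c • x) ≤ 𝓔 x + (1 − c)·(3·(LK·z)∕(R − 1))`, by ONE CALL of
`ShellMeasureRayWiring.rayBound_of_analytic_terms` with per-term oscillations `Lip i·e^{−δ′ϖP i}·z`.  Nothing of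
Bałaban's is asserted; every datum is DISPLAYED. [folklore] -/
theorem hE_of_pinned_terms {W : Set E} {ι : Type*} (I : Finset ι) {Ef : ι → (Λ → 𝔄) → ℂ} {rE : ℝ}
    (hEd : ∀ i ∈ I, DifferentiableOn ℂ (Ef i) (ball 0 rE))
    (supp : ι → Finset Λ) (hblind : ∀ i ∈ I, ∀ A A' : Λ → 𝔄, (∀ b ∈ supp i, A b = A' b) → Ef i A = Ef i A')
    {Lip : ι → ℝ} (hLip0 : ∀ i ∈ I, 0 ≤ Lip i)
    (hLip : ∀ i ∈ I, ∀ A ∈ ball (0 : Λ → 𝔄) rE, ∀ A' ∈ ball (0 : Λ → 𝔄) rE,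
      ‖Ef i A - Ef i A'‖ ≤ Lip i * ‖A - A'‖)
    (ϖ : Λ → ℝ) {δ' : ℝ} (hδ' : 0 ≤ δ') (ϖP : ι → ℝ) (hdepth : ∀ i ∈ I, ∀ b ∈ supp i, ϖP i ≤ ϖ b)
    {𝓗 : E → ℂ → (Λ → 𝔄)} {R : ℝ} (hR : 1 < R) (h𝓗d : ∀ x ∈ W, DifferentiableOn ℂ (𝓗 x) (ball 0 R))
    (h𝓗b : ∀ x ∈ W, MapsTo (𝓗 x) (ball (0 : ℂ) R) (ball (0 : Λ → 𝔄) rE))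
    {z : ℝ} (hz : 0 ≤ z)
    (hpin : ∀ x ∈ W, ∀ w ∈ ball (0 : ℂ) R, ∀ b, Real.exp (δ' * ϖ b) * ‖𝓗 x w b - 𝓗 x 0 b‖ ≤ z)
    {LK : ℝ} (hK : ∑ i ∈ I, Lip i * Real.exp (-(δ' * ϖP i)) ≤ LK)
    {𝓔 : E → ℝ} (hreal : ∀ x ∈ W, ∀ c : ℝ, 0 ≤ c → c ≤ 1 → (∑ i ∈ I, Ef i (𝓗 x (c : ℂ))).re = 𝓔 (c • x)) :
    ∀ x ∈ W, ∀ c : ℝ, 1 / 2 ≤ c → c ≤ 1 → 𝓔 (c • x) ≤ 𝓔 x + (1 - c) * (3 * (LK * z) / (R - 1)) := by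
  have hR0 : 0 < R := by linarith
  refine rayBound_of_analytic_terms (fun _ => I) (g := fun x i w => Ef i (𝓗 x w))
    (H := fun _ i => Lip i * Real.exp (-(δ' * ϖP i)) * z) hR
    (fun x hx i hi => (hEd i hi).comp (h𝓗d x hx) (h𝓗b x hx))
    (fun x hx i hi w hw => ?_) (fun x _ => ?_) hreal
  · -- the per-term oscillation: blind + Lipschitz on the ball + pinned variation
    exact norm_sub_le_of_blind_lipschitzOn_pin (Ef i) (supp i) (hblind i hi) (hLip0 i hi) (hLip i hi) ϖ hδ'
      (hdepth i hi) (h𝓗b x hx hw) (h𝓗b x hx (mem_ball_self hR0)) hz (hpin x hx w hw)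
  · -- the located sum
    rw [← Finset.sum_mul]
    exact mul_le_mul_of_nonneg_right hK hz

/-- … with END-II's second binder `hB𝓔 : 0 ≤ 3·(LK·z)∕(R − 1)` (`0 ≤ LK` from `0 ≤ Lip`). [folklore] -/
theorem hB𝓔_of_pinned_terms {ι : Type*} (I : Finset ι) {Lip : ι → ℝ} (hLip0 : ∀ i ∈ I, 0 ≤ Lip i) {δ' : ℝ}
    (ϖP : ι → ℝ) {R z LK : ℝ} (hR : 1 < R) (hz : 0 ≤ z) (hK : ∑ i ∈ I, Lip i * Real.exp (-(δ' * ϖP i)) ≤ LK) :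
    0 ≤ 3 * (LK * z) / (R - 1) :=
  rayConst_nonneg hR (mul_nonneg
    ((Finset.sum_nonneg fun i hi => mul_nonneg (hLip0 i hi) (Real.exp_nonneg _)).trans hK) hz)

/-- **`hE` FROM THE PER-TERM SUP PAIRS THEMSELVES** — the LD END's own `hEd`∕`hEb` currency, located and pinned: with
`‖Ef i‖ ≤ e i` on `ball 0 r_E` the Lipschitz constants are `2e_i∕r_E` on the half ball (§1), so a curve INTO
`ball 0 (r_E∕2)` (located coupling with `r_E∕2` in place of `r_E`) gives END-II's `hE` with
`B_𝓔 = 3·(LK·z)∕(R−1)`, `Σ_i (2e_i∕r_E)·e^{−δ′ϖP i} ≤ LK` — to be compared with the LD END's extensive `Σ_i 2e_i ≤ H̄`.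
[folklore] -/
theorem hE_of_pinned_pairs {W : Set E} {ι : Type*} (I : Finset ι) {Ef : ι → (Λ → 𝔄) → ℂ} {rE : ℝ} {e : ι → ℝ}
    (hEd : ∀ i ∈ I, DifferentiableOn ℂ (Ef i) (ball 0 rE))
    (hEb : ∀ i ∈ I, ∀ Z ∈ ball (0 : Λ → 𝔄) rE, ‖Ef i Z‖ ≤ e i) (he0 : ∀ i ∈ I, 0 ≤ e i) (hrE : 0 < rE)
    (supp : ι → Finset Λ) (hblind : ∀ i ∈ I, ∀ A A' : Λ → 𝔄, (∀ b ∈ supp i, A b = A' b) → Ef i A = Ef i A')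
    (ϖ : Λ → ℝ) {δ' : ℝ} (hδ' : 0 ≤ δ') (ϖP : ι → ℝ) (hdepth : ∀ i ∈ I, ∀ b ∈ supp i, ϖP i ≤ ϖ b)
    {𝓗 : E → ℂ → (Λ → 𝔄)} {R : ℝ} (hR : 1 < R) (h𝓗d : ∀ x ∈ W, DifferentiableOn ℂ (𝓗 x) (ball 0 R))
    (h𝓗b : ∀ x ∈ W, MapsTo (𝓗 x) (ball (0 : ℂ) R) (ball (0 : Λ → 𝔄) (rE / 2)))
    {z : ℝ} (hz : 0 ≤ z)
    (hpin : ∀ x ∈ W, ∀ w ∈ ball (0 : ℂ) R, ∀ b, Real.exp (δ' * ϖ b) * ‖𝓗 x w b - 𝓗 x 0 b‖ ≤ z)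
    {LK : ℝ} (hK : ∑ i ∈ I, 2 * e i / rE * Real.exp (-(δ' * ϖP i)) ≤ LK)
    {𝓔 : E → ℝ} (hreal : ∀ x ∈ W, ∀ c : ℝ, 0 ≤ c → c ≤ 1 → (∑ i ∈ I, Ef i (𝓗 x (c : ℂ))).re = 𝓔 (c • x)) :
    ∀ x ∈ W, ∀ c : ℝ, 1 / 2 ≤ c → c ≤ 1 → 𝓔 (c • x) ≤ 𝓔 x + (1 - c) * (3 * (LK * z) / (R - 1)) := by
  have hsub : ball (0 : Λ → 𝔄) (rE / 2) ⊆ ball 0 rE := ball_subset_ball (by linarith)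
  exact hE_of_pinned_terms I (fun i hi => (hEd i hi).mono hsub) supp hblind
    (Lip := fun i => 2 * e i / rE) (fun i hi => by have := he0 i hi; positivity)
    (fun i hi => lipschitzOn_half_of_pair (hEd i hi) (hEb i hi)) ϖ hδ' ϖP hdepth hR h𝓗d h𝓗b hz hpin hK hreal

end EndTwo

/-! ## §3 The volume-free numbers: located sums of the per-term constants -/

section Located

/-- **UNIFORM TERMS, PLACED**: `Lip i ≤ ℓ₀` on `I` and a located exponential sum `Σ_{i∈I} e^{−δ′ϖP i} ≤ K` ⟹
`Σ_{i∈I} Lip i·e^{−δ′ϖP i} ≤ ℓ₀·K` (S69 `sum_mul_le_of_pinned` with unit sizes). [folklore] -/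
theorem locatedSum_le_of_uniform {ι : Type*} (I : Finset ι) (Lip ϖP : ι → ℝ) {ℓ₀ δ' K : ℝ} (hℓ₀ : 0 ≤ ℓ₀)
    (hLip : ∀ i ∈ I, Lip i ≤ ℓ₀) (hK : ∑ i ∈ I, Real.exp (-(δ' * ϖP i)) ≤ K) :
    ∑ i ∈ I, Lip i * Real.exp (-(δ' * ϖP i)) ≤ ℓ₀ * K := by
  have h := sum_mul_le_of_pinned I (fun i => Lip i * Real.exp (-(δ' * ϖP i))) (fun _ => (1 : ℝ)) ϖP hℓ₀ zero_le_one
    (fun i hi => mul_le_mul_of_nonneg_right (hLip i hi) (Real.exp_nonneg _)) (fun _ _ => zero_le_one)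
    (fun _ _ => le_rfl) hK
  simpa using h

variable {d T : ℕ} [NeZero T]

/-- **ON THE TORUS, BY MULTIPLICITY** (the row's «≤ m per site» binder): terms placed by `pos : ι → (ℤ∕Tℤ)ᵈ` with at
most `m` per site, pin = the periodic ℓ¹ distance to the block's sites `B₀`, `δ′ > 0`, `Lip ≤ ℓ₀` ⟹
`Σ_i Lip i·e^{−δ′·pinDist B₀ (pos i)} ≤ ℓ₀·#B₀·m·K₁ d δ′` — NO `#ι`, NO `T` (S69 `sum_exp_neg_pinDist_le`). [folklore] -/
theorem locatedSum_le_torus {ι : Type*} [Fintype ι] (pos : ι → TPt d T) {m : ℕ}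
    (hm : ∀ x, (Finset.univ.filter fun i => pos i = x).card ≤ m) (B₀ : Finset (TPt d T)) (hB₀ : B₀.Nonempty)
    {δ' : ℝ} (hδ' : 0 < δ') (Lip : ι → ℝ) {ℓ₀ : ℝ} (hℓ₀ : 0 ≤ ℓ₀) (hLip : ∀ i, Lip i ≤ ℓ₀) :
    ∑ i, Lip i * Real.exp (-(δ' * pinDist B₀ hB₀ (pos i))) ≤ ℓ₀ * (B₀.card * (m * K₁ d δ')) :=
  locatedSum_le_of_uniform Finset.univ Lip (fun i => pinDist B₀ hB₀ (pos i)) hℓ₀ (fun i _ => hLip i)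
    (sum_exp_neg_pinDist_le pos hm B₀ hB₀ hδ')

/-- **THE WEIGHTED FIBRE BUDGET** (twin of S66 f3a `sum_comp_le_card_mul_sum` for families indexed by localization
DOMAINS rather than sites): terms anchored by `pos : ι → S` with per-anchor budget `Σ_{i : pos i = y} a i ≤ K₀` for
every site `y` and a nonnegative site function `f` ⟹ `Σ_i a i·f (pos i) ≤ K₀·Σ_y f y` — the shape of the located sum
of [Balaban1987RG1] (1.20) ∕ [Balaban1988Convergent] (2.42) (LOCATORS only: `a i = E₀e^{−κd_j(X_i)}`-type sizes,
`K₀` the tree-decay constant — displayed binders). [folklore] -/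
theorem sum_mul_comp_le_of_fibreBudget {ι S : Type*} [Fintype ι] [Fintype S] [DecidableEq S] (pos : ι → S)
    (a : ι → ℝ) {K₀ : ℝ} (hK : ∀ y, ∑ i ∈ Finset.univ.filter (fun i => pos i = y), a i ≤ K₀)
    (f : S → ℝ) (hf : ∀ y, 0 ≤ f y) :
    ∑ i, a i * f (pos i) ≤ K₀ * ∑ y, f y := by
  rw [← Finset.sum_fiberwise_of_maps_to (s := Finset.univ) (t := Finset.univ) (g := pos)
    (fun i _ => Finset.mem_univ _) (fun i => a i * f (pos i)), Finset.mul_sum]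
  refine Finset.sum_le_sum fun y _ => ?_
  have h : ∑ i ∈ Finset.univ.filter (fun i => pos i = y), a i * f (pos i) =
      (∑ i ∈ Finset.univ.filter (fun i => pos i = y), a i) * f y := by
    rw [Finset.sum_mul]
    exact Finset.sum_congr rfl fun i hi => by rw [(Finset.mem_filter.1 hi).2]
  rw [h]
  exact mul_le_mul_of_nonneg_right (hK y) (hf y)

/-- **ON THE TORUS, BY BUDGET**: anchored terms with per-anchor budget `Σ_{pos i = y} Lip i ≤ K₀`, `δ′ > 0` ⟹
`Σ_i Lip i·e^{−δ′·pinDist B₀ (pos i)} ≤ K₀·#B₀·K₁ d δ′` — volume-free for polymer-indexed families (no multiplicity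
bound needed). [folklore] -/
theorem locatedSum_le_torus_of_fibreBudget {ι : Type*} [Fintype ι] (pos : ι → TPt d T) (Lip : ι → ℝ)
    {K₀ : ℝ} (hK₀ : 0 ≤ K₀) (hK : ∀ y, ∑ i ∈ Finset.univ.filter (fun i => pos i = y), Lip i ≤ K₀)
    (B₀ : Finset (TPt d T)) (hB₀ : B₀.Nonempty) {δ' : ℝ} (hδ' : 0 < δ') :
    ∑ i, Lip i * Real.exp (-(δ' * pinDist B₀ hB₀ (pos i))) ≤ K₀ * (B₀.card * K₁ d δ') := by
  classical
  refine (sum_mul_comp_le_of_fibreBudget pos Lip hK (fun y => Real.exp (-(δ' * pinDist B₀ hB₀ y)))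
    fun y => Real.exp_nonneg _).trans (mul_le_mul_of_nonneg_left ?_ hK₀)
  -- one index per site: S69's count with `m = 1`
  have h := sum_exp_neg_pinDist_le (P := TPt d T) id (m := 1)
    (fun y => by
      rw [Finset.card_le_one]
      intro p hp q hq
      simp only [Finset.mem_filter, Finset.mem_univ, true_and, id] at hp hq
      rw [hp, hq]) B₀ hB₀ hδ'
  simpa using h

end Located

/-! ## §3b The END on the torus: END-II's `hE` ∕ `hB𝓔` with a VOLUME-FREE `B_𝓔` -/

section EndTorus

variable {E : Type*} [AddCommGroup E] [Module ℝ E] {d T : ℕ} [NeZero T]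

/-- **ROW S71's END ON THE TORUS.**  Terms `i : ι` (a finite type; all terms of the action allowed) placed by their
localization sites `pos : ι → (ℤ∕Tℤ)ᵈ` with at most `m` per site (the (0.26)-type inner sum — a displayed binder),
supports at pin-depth `≥ pinDist B₀ (pos i)` for the block's site set `B₀`, per-term Lipschitz constants `≤ ℓ₀` on the
ball, pinned variation of the curve `≤ z` at rate `δ′ > 0` ⟹ END-II's `hE` with
`B_𝓔 = 3·(ℓ₀·(#B₀·(m·K₁ d δ′))·z)∕(R − 1)` — NO `#ι`, NO `T`: the non-Wilson ray cost is VOLUME-FREE.  (S16 + §1 + S69.)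
[folklore] -/
theorem hE_of_pinned_terms_torus {W : Set E} {ι : Type*} [Fintype ι] {Ef : ι → (Λ → 𝔄) → ℂ} {rE : ℝ}
    (hEd : ∀ i, DifferentiableOn ℂ (Ef i) (ball 0 rE))
    (supp : ι → Finset Λ) (hblind : ∀ i, ∀ A A' : Λ → 𝔄, (∀ b ∈ supp i, A b = A' b) → Ef i A = Ef i A')
    {Lip : ι → ℝ} {ℓ₀ : ℝ} (hℓ₀ : 0 ≤ ℓ₀) (hLip0 : ∀ i, 0 ≤ Lip i) (hLipℓ : ∀ i, Lip i ≤ ℓ₀)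
    (hLip : ∀ i, ∀ A ∈ ball (0 : Λ → 𝔄) rE, ∀ A' ∈ ball (0 : Λ → 𝔄) rE, ‖Ef i A - Ef i A'‖ ≤ Lip i * ‖A - A'‖)
    (pos : ι → TPt d T) {m : ℕ} (hm : ∀ x, (Finset.univ.filter fun i => pos i = x).card ≤ m)
    (B₀ : Finset (TPt d T)) (hB₀ : B₀.Nonempty) (ϖ : Λ → ℝ) {δ' : ℝ} (hδ' : 0 < δ')
    (hdepth : ∀ i, ∀ b ∈ supp i, pinDist B₀ hB₀ (pos i) ≤ ϖ b)
    {𝓗 : E → ℂ → (Λ → 𝔄)} {R : ℝ} (hR : 1 < R) (h𝓗d : ∀ x ∈ W, DifferentiableOn ℂ (𝓗 x) (ball 0 R))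
    (h𝓗b : ∀ x ∈ W, MapsTo (𝓗 x) (ball (0 : ℂ) R) (ball (0 : Λ → 𝔄) rE))
    {z : ℝ} (hz : 0 ≤ z)
    (hpin : ∀ x ∈ W, ∀ w ∈ ball (0 : ℂ) R, ∀ b, Real.exp (δ' * ϖ b) * ‖𝓗 x w b - 𝓗 x 0 b‖ ≤ z)
    {𝓔 : E → ℝ} (hreal : ∀ x ∈ W, ∀ c : ℝ, 0 ≤ c → c ≤ 1 → (∑ i, Ef i (𝓗 x (c : ℂ))).re = 𝓔 (c • x)) :
    (∀ x ∈ W, ∀ c : ℝ, 1 / 2 ≤ c → c ≤ 1 →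
      𝓔 (c • x) ≤ 𝓔 x + (1 - c) * (3 * (ℓ₀ * (B₀.card * (m * K₁ d δ')) * z) / (R - 1))) ∧
      0 ≤ 3 * (ℓ₀ * (B₀.card * (m * K₁ d δ')) * z) / (R - 1) :=
  have hK := locatedSum_le_torus pos hm B₀ hB₀ hδ' Lip hℓ₀ hLipℓ
  ⟨hE_of_pinned_terms Finset.univ (fun i _ => hEd i) supp (fun i _ => hblind i) (fun i _ => hLip0 i)
      (fun i _ => hLip i) ϖ hδ'.le (fun i => pinDist B₀ hB₀ (pos i)) (fun i _ => hdepth i) hR h𝓗d h𝓗b hz hpin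
      hK hreal,
    hB𝓔_of_pinned_terms Finset.univ (fun i _ => hLip0 i) (fun i => pinDist B₀ hB₀ (pos i)) hR hz hK⟩

end EndTorus

/-! ## §4 The junction with row S70's pinned-norm statement -/

section PinJunction

/-- **FROM THE PINNED NORM TO THE COMPONENTWISE PIN.**  If the variation, read in S69's pinned space
`WSup (pinW δ′ ϖ) 1 𝔄`, has norm `≤ z`, then `e^{δ′ϖ b}·‖Z b − Z₀ b‖ ≤ z` for every `b` — the hypothesis `hpin` of §2 in
the currency row S70 delivers (`‖Z_V(w•x) − Z_V(0)‖_pin ≤ z`). [folklore] -/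
theorem pin_of_norm_sub_le (δ' : ℝ) (ϖ : Λ → ℝ) (Z Z₀ : WSup (pinW δ' ϖ) 1 𝔄) {z : ℝ} (h : ‖Z - Z₀‖ ≤ z) (b : Λ) :
    Real.exp (δ' * ϖ b) * ‖Z b - Z₀ b‖ ≤ z := by
  have h1 := WSup.norm_apply_le (pinW δ' ϖ) 1 (Z - Z₀) b
  rw [pow_one, pinW_apply] at h1
  exact h1.trans h

/-- The same for a curve `𝓗 : ℂ → WSup (pinW δ′ ϖ) 1 𝔄` with `‖𝓗 w − 𝓗 0‖ ≤ z` on the disc: the flat curve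
`w ↦ toPiL (𝓗 w)` satisfies `hpin`. [folklore] -/
theorem hpin_of_pinnedCurve (δ' : ℝ) (ϖ : Λ → ℝ) {R z : ℝ} (𝓗 : ℂ → WSup (pinW δ' ϖ) 1 𝔄)
    (h : ∀ w ∈ ball (0 : ℂ) R, ‖𝓗 w - 𝓗 0‖ ≤ z) :
    ∀ w ∈ ball (0 : ℂ) R, ∀ b,
      Real.exp (δ' * ϖ b) * ‖WSup.toPiL (pinW δ' ϖ) 1 (𝓗 w) b - WSup.toPiL (pinW δ' ϖ) 1 (𝓗 0) b‖ ≤ z :=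
  fun w hw b => by
    rw [WSup.toPiL_apply, WSup.toPiL_apply]
    exact pin_of_norm_sub_le δ' ϖ (𝓗 w) (𝓗 0) (h w hw) b

end PinJunction

/-! ## §5 Non-vacuity: one linear located term along a linear curve -/

section Toy

/-- NON-VACUITY of `hE_of_pinned_terms` on the line `E = ℝ`, `Λ = Unit`, `𝔄 = ℂ`: ONE term `Ef Z = a·Z ⋆` (entire,
blind off `{⋆}`, `‖a‖`-Lipschitz), curve `𝓗 x w = (w·x)·1` on the disc `‖w‖ < 2` for `x ∈ [−1,1]` (into `ball 0 3`),
pin `ϖ ≡ 0`, `δ′ = 0`, pinned variation `z = 2`, `𝓔 y = Re(a)·y`: every hypothesis holds and the binder reads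
`Re(a)·(c x) ≤ Re(a)·x + (1 − c)·3·(‖a‖·2)∕(2 − 1)`.  So the binder shapes are jointly inhabited. [folklore] -/
example (a : ℂ) :
    ∀ x ∈ Icc (-1 : ℝ) 1, ∀ c : ℝ, 1 / 2 ≤ c → c ≤ 1 →
      a.re * (c • x) ≤ a.re * x + (1 - c) * (3 * ((‖a‖ * Real.exp (-(0 * 0))) * 2) / (2 - 1)) := by
  have h := hE_of_pinned_terms (Λ := Unit) (𝔄 := ℂ) (E := ℝ) (W := Icc (-1 : ℝ) 1) ({()} : Finset Unit)
    (Ef := fun _ Z => a * Z ()) (rE := 3)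
    (fun _ _ => ((differentiable_const a).mul
      (ContinuousLinearMap.proj (R := ℂ) (φ := fun _ : Unit => ℂ) ()).differentiable).differentiableOn)
    (fun _ => {()}) (fun _ _ A A' hAA' => by simp [hAA' () (Finset.mem_singleton_self _)])
    (Lip := fun _ => ‖a‖) (fun _ _ => norm_nonneg a)
    (fun _ _ A _ A' _ => by
      calc ‖a * A () - a * A' ()‖ = ‖a‖ * ‖(A - A') ()‖ := by rw [← mul_sub, norm_mul, Pi.sub_apply]
        _ ≤ ‖a‖ * ‖A - A'‖ := mul_le_mul_of_nonneg_left (norm_le_pi_norm _ _) (norm_nonneg a))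
    (fun _ => (0 : ℝ)) (δ' := 0) le_rfl (fun _ => (0 : ℝ)) (fun _ _ _ _ => le_rfl)
    (𝓗 := fun x w _ => w * (x : ℂ)) (R := 2) one_lt_two
    (fun x _ => differentiableOn_pi.2 fun _ => (differentiable_id.mul (differentiable_const _)).differentiableOn)
    (fun x hx w hw => by
      rw [mem_ball_zero_iff] at hw ⊢
      have hx1 : |x| ≤ 1 := abs_le.2 hx
      have : ‖(fun _ : Unit => w * (x : ℂ))‖ = ‖w‖ * |x| := by
        rw [pi_norm_const, norm_mul, Complex.norm_real, Real.norm_eq_abs]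
      rw [this]
      nlinarith [norm_nonneg w, abs_nonneg x])
    (z := 2) zero_le_two
    (fun x hx w hw _ => by
      rw [mem_ball_zero_iff] at hw
      have hx1 : |x| ≤ 1 := abs_le.2 hx
      simp only [zero_mul, Real.exp_zero, one_mul, mul_zero, sub_zero]
      rw [norm_mul, Complex.norm_real, Real.norm_eq_abs]
      nlinarith [norm_nonneg w, abs_nonneg x])
    (LK := ‖a‖ * Real.exp (-(0 * 0))) (by simp)
    (𝓔 := fun y => a.re * y)
    (fun x _ c _ _ => by simp [smul_eq_mul])
  exact h

end Toy

end Summit.QuantumFields.BalabanUV.T4Continuum.ShellMeasureRayTermsPinned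

end
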